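import Literature.Barriers.RiemannHypothesis.MollifierLimitationsPropBBounds
import Literature.Barriers.RiemannHypothesis.MollifierLimitationsPropB
import HarnessLib

/-!
# Radziwiłł 2012, §7 (Soundararajan's quadratic form), part C: the assembly —
# discharge of `Radziwill2012_propB_quadForm`

Third and last file of the proof of the named fact
`Literature.Barriers.RiemannHypothesis.Radziwill2012_propB_quadForm`
(`Literature/Barriers/RiemannHypothesis/MollifierLimitationsPropB.lean`): for `0 < θ < 1` and
`ε > 0` there is `T₀` such that for all `T ≥ T₀` and all `a : ℕ → ℂ` with `a(1) = 1`,
`𝒬_T(a) = ∑_{m,n ≤ N} a(m)ā(n)/[m,n]·(log(T(m,n)²/(2πmn)) + 2log 2 + 2γ − 1) ≥ 1 + 1/θ − ε`,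
`N = ⌊T^θ⌋` (M. Radziwiłł, *Limitations to mollifying ζ(s)*, arXiv:1207.6583, §7 — Soundararajan's
argument). Parts A (`MollifierLimitationsPropBDiag.lean`) and B (`MollifierLimitationsPropBBounds.lean`)
supply the identities and the estimates; here:

* `bchQuadForm_eq_re` — `𝒬_T(a) = L_T · Re F₁ − Re F₂` with
  `L_T = log T + 2log2 + 2γ − 1 − log(2π)` (`= log(cT)`, `c = 4e^{2γ−1}/(2π)`, the form (7.1));
* `bchQuadForm_ge_core` — the deduction of §7 in closed form: for `N ≥ 3`, `a(1) = 1`,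
  `𝒬_T(a) ≥ 1 + L_T/G − C₁₄/log N − K_N²/(A·G)` whenever
  `A := L_T − log N − 6 − 4(log log N + 3) > 0`, where `K_N = C₁₃ + log log N`; this is
  "Adding the equations (7.4) and (7.5)" with Lemma 9 (`Re F₁ = 1/G + D`), the signed Lemma 11
  (`Re F₂ ≤ 2Re B(y,y)`), the decomposition (7.9), Lemma 14 (`−2B(z,z) ≥ 1 − C₁₄/log N`),
  Lemma 12 (`2|B(w,w)| ≤ (log N + 6 + 4 log log N + 12)·D`) and Lemma 13
  (`2|Re(B(z,w)+B(w,z))| ≤ 2K_N√(D/G)`), the terms in `D` being absorbed by completing the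
  square, `A·D − 2K_N√(D/G) ≥ −K_N²/(AG)` (the printed argument drops them using
  `1 − θ − ε > 0`);
* `Radziwill2012_propB_quadForm_holds` — **the discharge**: with `N = ⌊T^θ⌋`, `log T ≥ (log N)/θ`,
  `G = log N + O(1)`, so `L_T/G → 1/θ`, `A ≥ (1/θ − 1)(log N)/2 → ∞` (this is where `θ < 1` is
  used) and the two error terms tend to `0`.

## References

* [Radziwill2012] M. Radziwiłł, *Limitations to mollifying ζ(s)*, arXiv:1207.6583 (2012), §7,
  p. 12 (the deduction of Proposition B from Lemmas 9 and 10, displays (7.3)–(7.5)).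
-/

noncomputable section

open Finset ArithmeticFunction Complex Filter Real
open scoped ArithmeticFunction.Moebius ArithmeticFunction.zeta ComplexConjugate Topology

namespace Literature.Barriers.RiemannHypothesis

namespace PropB

/-! ### `𝒬_T(a) = L_T Re F₁ − Re F₂` -/

/-- `L_T = log T + 2 log 2 + 2γ − 1 − log(2π)` (`= log(cT)` with `c = 4e^{2γ−1}/(2π)`, the
coefficient of the first form in (7.1)). [cite: Radziwill2012, §7 (7.1)] -/
def LT (T : ℝ) : ℝ :=
  Real.log T + 2 * Real.log 2 + 2 * Real.eulerMascheroniConstant - 1 - Real.log (2 * π)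

/-- The kernel of `𝒬_T`: `log(T(m,n)²/(2πmn)) + 2log2 + 2γ − 1 = L_T − log([m,n]/(m,n))`.
[cite: Radziwill2012, §7 (7.1)] -/
theorem kernel_eq {T : ℝ} (hT : 0 < T) {m n : ℕ} (hm : m ≠ 0) (hn : n ≠ 0) :
    Real.log (T * (Nat.gcd m n : ℝ) ^ 2 / (2 * π * m * n)) + 2 * Real.log 2 +
        2 * Real.eulerMascheroniConstant - 1 =
      LT T - Real.log ((Nat.lcm m n : ℝ) / (Nat.gcd m n : ℝ)) := by
  rw [log_lcm_div_gcd hm hn, LT]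
  have hg : (Nat.gcd m n : ℝ) ≠ 0 := by exact_mod_cast Nat.gcd_ne_zero_left hm
  have hm' : (m : ℝ) ≠ 0 := by exact_mod_cast hm
  have hn' : (n : ℝ) ≠ 0 := by exact_mod_cast hn
  have hπ : (2 * π : ℝ) ≠ 0 := by positivity
  rw [Real.log_div (by positivity) (by positivity), Real.log_mul (by positivity) (pow_ne_zero 2 hg),
    Real.log_pow, Real.log_mul (mul_ne_zero hπ hm') hn', Real.log_mul hπ hm']
  push_cast
  ring

/-- **`𝒬_T(a) = L_T · Re F₁ − Re F₂`** (`T > 0`). [cite: Radziwill2012, §7 (7.1)] -/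
theorem bchQuadForm_eq_re {T : ℝ} (hT : 0 < T) (N : ℕ) (a : ℕ → ℂ) :
    bchQuadForm T N a = LT T * (F1 N a).re - (F2 N a).re := by
  unfold bchQuadForm F1 F2
  rw [Complex.re_sum, Complex.re_sum, Finset.mul_sum, ← Finset.sum_sub_distrib]
  refine Finset.sum_congr rfl fun m hm => ?_
  rw [Complex.re_sum, Complex.re_sum, Finset.mul_sum, ← Finset.sum_sub_distrib]
  refine Finset.sum_congr rfl fun n hn => ?_
  have hm0 : m ≠ 0 := by have := (mem_Icc.1 hm).1; omega
  have hn0 : n ≠ 0 := by have := (mem_Icc.1 hn).1; omega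
  rw [kernel_eq hT hm0 hn0, Complex.re_mul_ofReal, Complex.div_natCast_re]
  ring

/-! ### The core lower bound -/

/-- `log(N/ℓ)` for natural division: `∑_{m ≤ N/ℓ} Λ(m)/m ≤ log N − log ℓ + 6` (`1 ≤ ℓ ≤ N`).
[folklore] -/
theorem sum_vonMangoldt_div_le_log_sub {N ℓ : ℕ} (hℓ : ℓ ∈ Icc 1 N) :
    ∑ m ∈ Icc 1 (N / ℓ), Λ m / m ≤ Real.log N - Real.log ℓ + 6 := by
  obtain ⟨hℓ1, hℓN⟩ := mem_Icc.1 hℓ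
  have hX1 : 1 ≤ N / ℓ := (Nat.le_div_iff_mul_le (by omega)).2 (by simpa using hℓN)
  have h := sum_vonMangoldt_div_le hX1
  have hℓpos : (0 : ℝ) < ℓ := by exact_mod_cast hℓ1
  have hNpos : (0 : ℝ) < N := by exact_mod_cast (show 0 < N by omega)
  have hXpos : (0 : ℝ) < (N / ℓ : ℕ) := by exact_mod_cast hX1
  have hlog : Real.log ((N / ℓ : ℕ) : ℝ) ≤ Real.log N - Real.log ℓ := by
    rw [← Real.log_div hNpos.ne' hℓpos.ne']
    exact Real.log_le_log hXpos Nat.cast_div_le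
  linarith

/-- **The deduction of §7, in closed form.** For `N ≥ 3`, `T > 0`, `a(1) = 1`:
`𝒬_T(a) ≥ 1 + L_T/G − C₁₄/log N − K_N²/(A·G)` with `K_N = C₁₃ + log log N`,
`A = L_T − log N − 6 − 4(log log N + 3)`, provided `A > 0`; here `C₁₃`, `C₁₄` are the constants
of `exists_abs_rho_add_le` (Lemma 13) and `exists_main_term_ge` (Lemma 14).
[cite: Radziwill2012, §7 (7.3)–(7.5)] -/
theorem bchQuadForm_ge_core {N : ℕ} (hN : 3 ≤ N) {T : ℝ} (hT : 0 < T) (a : ℕ → ℂ)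
    (ha : a 1 = 1) {Cρ C₇ : ℝ} (hCρ0 : 0 ≤ Cρ)
    (hCρ : ∀ ℓ ∈ Icc 1 N, |rho N ℓ + (μ ℓ : ℝ) * (Real.log N - Real.log ℓ)| ≤
      (Cρ + Real.log (Real.log N)) * ((μ ℓ : ℝ)) ^ 2)
    (hC₇ : 1 - C₇ / Real.log N ≤
      2 / Gs N ^ 2 * ∑ k ∈ Icc 1 N, ((μ k : ℝ)) ^ 2 * Real.log k / (k.totient : ℝ))
    {A : ℝ} (hAdef : A = LT T - Real.log N - 6 - 4 * (Real.log (Real.log N) + 3)) (hA : 0 < A) :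
    1 + LT T / Gs N - C₇ / Real.log N - (Cρ + Real.log (Real.log N)) ^ 2 / (A * Gs N) ≤
      bchQuadForm T N a := by
  have hN1 : 1 ≤ N := by omega
  have hG1 := one_le_Gs hN1
  have hGpos : 0 < Gs N := by linarith
  set K := Cρ + Real.log (Real.log N) with hK
  have hN3 : (3 : ℝ) ≤ N := by exact_mod_cast hN
  have hlogN1 : 1 ≤ Real.log N := by
    rw [← Real.log_exp 1]
    apply Real.log_le_log (Real.exp_pos 1)
    have := Real.exp_one_lt_d9; linarith
  have hK0 : 0 ≤ K := by
    have := Real.log_nonneg hlogN1; rw [hK]; linarith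
  set D := Dv N a with hD
  have hD0 : 0 ≤ D := Finset.sum_nonneg fun ℓ _ => by positivity
  -- (1) `Re F₁ = 1/G + D`
  have hF1 : (F1 N a).re = 1 / Gs N + D := by
    have := Dv_eq a ha hN1; rw [hD]; linarith
  -- (2) `Re F₂ ≤ 2 Re B(y,y)` and the decomposition
  have hF2 := re_F2_le (N := N) a
  rw [Bf_yv_yv] at hF2
  simp only [Complex.add_re] at hF2
  -- (3) the three pieces
  -- `S₃`
  have hzz : 2 * (Bf N (zC N) (zC N)).re ≤ -(1 - C₇ / Real.log N) := by
    rw [Bf_zC_zC hN1, Complex.ofReal_re]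
    have : 2 * (-(1 / Gs N ^ 2) * ∑ k ∈ Icc 1 N, ((μ k : ℝ)) ^ 2 * Real.log k / (k.totient : ℝ)) =
        -(2 / Gs N ^ 2 * ∑ k ∈ Icc 1 N, ((μ k : ℝ)) ^ 2 * Real.log k / (k.totient : ℝ)) := by ring
    rw [this]
    linarith
  -- `S₂`
  have hcross : 2 * ((Bf N (zC N) (wv N a)).re + (Bf N (wv N a) (zC N)).re) ≤
      2 * (K / Gs N) * Real.sqrt (Gs N * D) := by
    have h1 := abs_re_Bf_cross_le a ha hN1 (K := K) (L := Real.log N) hCρ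
    have h2 := sum_moebius_sq_mul_norm_div_le a hN1
    have h3 := (le_abs_self _).trans h1
    rw [Complex.add_re] at h3
    have h4 : K / Gs N * ∑ ℓ ∈ Icc 1 N, ((μ ℓ : ℝ)) ^ 2 * ‖wv N a ℓ‖ / ℓ ≤
        K / Gs N * Real.sqrt (Gs N * D) := mul_le_mul_of_nonneg_left h2 (by positivity)
    linarith
  -- `S₁`
  have hww : 2 * (Bf N (wv N a) (wv N a)).re ≤
      (Real.log N + 6 + 4 * (Real.log (Real.log N) + 3)) * D := by
    have h1 := two_mul_norm_Bf_wv_wv_le (N := N) a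
    have h2 : (Bf N (wv N a) (wv N a)).re ≤ ‖Bf N (wv N a) (wv N a)‖ := Complex.re_le_norm _
    -- first sum
    have h3 : ∑ ℓ ∈ Icc 1 N, (ℓ.totient : ℝ) / (ℓ : ℝ) ^ 2 * ‖wv N a ℓ‖ ^ 2 *
        ∑ m ∈ Icc 1 (N / ℓ), Λ m / m ≤
        ∑ ℓ ∈ Icc 1 N, (ℓ.totient : ℝ) / (ℓ : ℝ) ^ 2 * ‖wv N a ℓ‖ ^ 2 *
          (Real.log N - Real.log ℓ + 6) := by
      refine Finset.sum_le_sum fun ℓ hℓ => ?_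
      exact mul_le_mul_of_nonneg_left (sum_vonMangoldt_div_le_log_sub hℓ) (by positivity)
    -- second sum
    have h4 : ∑ k ∈ Icc 1 N, hAF k / (k : ℝ) ^ 2 * ‖wv N a k‖ ^ 2 ≤
        ∑ k ∈ Icc 1 N, (k.totient : ℝ) / (k : ℝ) ^ 2 * ‖wv N a k‖ ^ 2 *
          (Real.log k + 4 * (Real.log (Real.log N) + 3)) := by
      refine Finset.sum_le_sum fun k hk => ?_
      obtain ⟨hk1, hkN⟩ := mem_Icc.1 hk
      have h := hAF_le hN hk1 hkN
      have h0 : 0 ≤ ‖wv N a k‖ ^ 2 / (k : ℝ) ^ 2 := by positivity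
      calc hAF k / (k : ℝ) ^ 2 * ‖wv N a k‖ ^ 2 = hAF k * (‖wv N a k‖ ^ 2 / (k : ℝ) ^ 2) := by ring
        _ ≤ (k.totient : ℝ) * (Real.log k + 4 * (Real.log (Real.log N) + 3)) *
            (‖wv N a k‖ ^ 2 / (k : ℝ) ^ 2) := mul_le_mul_of_nonneg_right h h0
        _ = _ := by ring
    have h5 : ∑ ℓ ∈ Icc 1 N, (ℓ.totient : ℝ) / (ℓ : ℝ) ^ 2 * ‖wv N a ℓ‖ ^ 2 *
          (Real.log N - Real.log ℓ + 6) +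
        ∑ k ∈ Icc 1 N, (k.totient : ℝ) / (k : ℝ) ^ 2 * ‖wv N a k‖ ^ 2 *
          (Real.log k + 4 * (Real.log (Real.log N) + 3)) =
        (Real.log N + 6 + 4 * (Real.log (Real.log N) + 3)) * D := by
      rw [← Finset.sum_add_distrib, hD, Dv, Finset.mul_sum]
      refine Finset.sum_congr rfl fun ℓ _ => ?_
      ring
    linarith
  -- (4) assemble
  rw [bchQuadForm_eq_re hT, hF1]
  have hmain : LT T * (1 / Gs N + D) - (F2 N a).re ≥
      1 + LT T / Gs N - C₇ / Real.log N +
        (A * D - 2 * (K / Gs N) * Real.sqrt (Gs N * D)) := by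
    rw [hAdef]
    have : LT T * (1 / Gs N + D) = LT T / Gs N + LT T * D := by ring
    nlinarith [hF2, hzz, hcross, hww]
  -- (5) complete the square: `A D − 2(K/G)√(GD) ≥ −K²/(AG)`
  have hsq : -(K ^ 2 / (A * Gs N)) ≤ A * D - 2 * (K / Gs N) * Real.sqrt (Gs N * D) := by
    set x := Real.sqrt (Gs N * D) with hx
    have hx2 : x ^ 2 = Gs N * D := Real.sq_sqrt (by positivity)
    have hDx : D = x ^ 2 / Gs N := by
      field_simp; linarith [hx2]
    rw [hDx]
    have key : A * (x ^ 2 / Gs N) - 2 * (K / Gs N) * x + K ^ 2 / (A * Gs N) =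
        (A * x - K) ^ 2 / (A * Gs N) := by
      field_simp
      ring
    have : 0 ≤ (A * x - K) ^ 2 / (A * Gs N) := by positivity
    linarith
  linarith

/-! ### Elementary asymptotics in `L = log N` -/

/-- For `c > 0` and any `B`: `B + 4 log L ≤ c L` for all large `L`. [folklore] -/
theorem exists_add_log_le_mul {c : ℝ} (hc : 0 < c) (B : ℝ) :
    ∃ L₀ : ℝ, ∀ L : ℝ, L₀ ≤ L → B + 4 * Real.log L ≤ c * L := by
  -- `4 log L ≤ 8 √L ≤ (c/2) L` once `√L ≥ 16/c`, and `B ≤ (c/2) L` once `L ≥ 2B/c`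
  refine ⟨max 1 (max (2 * |B| / c) ((16 / c) ^ 2)), fun L hL => ?_⟩
  have hL1 : 1 ≤ L := le_trans (le_max_left _ _) hL
  have hL0 : 0 < L := by linarith
  have hLB : 2 * |B| / c ≤ L := le_trans (le_trans (le_max_left _ _) (le_max_right _ _)) hL
  have hLc : (16 / c) ^ 2 ≤ L := le_trans (le_trans (le_max_right _ _) (le_max_right _ _)) hL
  have hsqrt : 16 / c ≤ Real.sqrt L := by
    rw [← Real.sqrt_sq (by positivity : (0 : ℝ) ≤ 16 / c)]
    exact Real.sqrt_le_sqrt hLc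
  have hlog := Literature.NumberTheory.Sieve.SelbergSymmetry.log_le_two_mul_sqrt hL0
  have h1 : 8 * Real.sqrt L ≤ c / 2 * L := by
    have hs0 : 0 ≤ Real.sqrt L := Real.sqrt_nonneg L
    have : c / 2 * L = c / 2 * (Real.sqrt L * Real.sqrt L) := by
      rw [Real.mul_self_sqrt hL0.le]
    rw [this]
    have h16 : 16 ≤ c * Real.sqrt L := by
      have := mul_le_mul_of_nonneg_left hsqrt hc.le
      rwa [mul_div_cancel₀ _ hc.ne'] at this
    nlinarith
  have h2 : B ≤ c / 2 * L := by
    have : |B| ≤ c / 2 * L := by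
      rw [div_le_iff₀ hc] at hLB
      nlinarith
    exact (le_abs_self B).trans this
  linarith

/-- For `θ > 0`, `κ`, `C ≥ 0` and `η > 0`: `((1/θ)L + κ)/(L + 1 + C) ≥ 1/θ − η` for all large
`L`. [folklore] -/
theorem exists_ratio_ge {θ : ℝ} (hθ : 0 < θ) (κ : ℝ) {C : ℝ} (hC : 0 ≤ C) {η : ℝ} (hη : 0 < η) :
    ∃ L₀ : ℝ, ∀ L : ℝ, L₀ ≤ L → 1 / θ - η ≤ (1 / θ * L + κ) / (L + 1 + C) := by
  refine ⟨max 1 ((1 / θ * (1 + C) + |κ|) / η), fun L hL => ?_⟩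
  have hL1 : 1 ≤ L := le_trans (le_max_left _ _) hL
  have hL2 : (1 / θ * (1 + C) + |κ|) / η ≤ L := le_trans (le_max_right _ _) hL
  have hden : 0 < L + 1 + C := by linarith
  rw [le_div_iff₀ hden]
  rw [div_le_iff₀ hη] at hL2
  have hκ := neg_abs_le κ
  have hθ' : 0 < 1 / θ := by positivity
  nlinarith [mul_nonneg hη.le (by linarith : (0 : ℝ) ≤ L - 1), mul_nonneg hθ'.le hC]

/-- For `c > 0`, `Cρ ≥ 0`, `η > 0`: `(Cρ + log L)²/(c L · (L/2)) ≤ η` for all large `L`.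
[folklore] -/
theorem exists_err_le {c : ℝ} (hc : 0 < c) (Cρ : ℝ) {η : ℝ} (hη : 0 < η) :
    ∃ L₀ : ℝ, ∀ L : ℝ, L₀ ≤ L → (Cρ + Real.log L) ^ 2 / (c * L * (L / 2)) ≤ η := by
  refine ⟨max 1 ((4 * Cρ ^ 2 + 16) / (c * η)), fun L hL => ?_⟩
  have hL1 : 1 ≤ L := le_trans (le_max_left _ _) hL
  have hL0 : 0 < L := by linarith
  have hL2 : (4 * Cρ ^ 2 + 16) / (c * η) ≤ L := le_trans (le_max_right _ _) hL
  have hlog := Literature.NumberTheory.Sieve.SelbergSymmetry.log_le_two_mul_sqrt hL0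
  have hlog0 : 0 ≤ Real.log L := Real.log_nonneg hL1
  have hs : Real.sqrt L ^ 2 = L := Real.sq_sqrt hL0.le
  -- `(Cρ + log L)² ≤ 2Cρ² + 2 (log L)² ≤ 2Cρ² + 8L`
  have h1 : (Cρ + Real.log L) ^ 2 ≤ 2 * Cρ ^ 2 + 8 * L := by
    nlinarith [sq_nonneg (Cρ - Real.log L)]
  rw [div_le_iff₀ (by positivity)]
  rw [div_le_iff₀ (by positivity)] at hL2
  nlinarith [mul_nonneg (mul_nonneg hc.le hη.le) (by linarith : (0 : ℝ) ≤ L - 1)]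

/-! ### The discharge -/

/-- `κ = 2 log 2 + 2γ − 1 − log(2π) > −1` (numerically `κ ≈ −0.30`). [folklore] -/
theorem neg_one_lt_kappa :
    -1 < 2 * Real.log 2 + 2 * Real.eulerMascheroniConstant - 1 - Real.log (2 * π) := by
  have h2 := Real.log_two_gt_d9
  have hγ := Real.one_half_lt_eulerMascheroniConstant
  have he1 := Real.exp_one_gt_d9
  have hπ := Real.pi_lt_d2
  have hexp2 : (7.3 : ℝ) < Real.exp 2 := by
    have : Real.exp 2 = Real.exp 1 * Real.exp 1 := by rw [← Real.exp_add]; norm_num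
    rw [this]; nlinarith
  have hlogπ : Real.log (2 * π) < 2 := by
    rw [Real.log_lt_iff_lt_exp (by positivity)]
    linarith
  linarith

/-- **Discharge of `Radziwill2012_propB_quadForm`** (Radziwiłł 2012, Proposition B, second relation;
Soundararajan): for `0 < θ < 1` and `ε > 0` there is `T₀` with
`𝒬_T(a) ≥ 1 + 1/θ − ε` for all `T ≥ T₀` and all `a : ℕ → ℂ` with `a(1) = 1` (`N = ⌊T^θ⌋`).
[cite: Radziwill2012, Proposition B and §7] -/
theorem Radziwill2012_propB_quadForm_holds : Radziwill2012_propB_quadForm := by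
  intro θ hθ hθ1 ε hε
  -- constants
  obtain ⟨CG, hCG0, hCG⟩ := exists_abs_Gs_sub_log_le
  obtain ⟨Cρ, hCρ0, hCρ⟩ := exists_abs_rho_add_le
  obtain ⟨C₇, hC₇0, hC₇⟩ := exists_main_term_ge
  obtain ⟨κ, hκ⟩ : ∃ κ : ℝ,
      κ = 2 * Real.log 2 + 2 * Real.eulerMascheroniConstant - 1 - Real.log (2 * π) := ⟨_, rfl⟩
  have hκlo : -1 < κ := by rw [hκ]; exact neg_one_lt_kappa
  obtain ⟨c, hc⟩ : ∃ c : ℝ, c = (1 / θ - 1) / 2 := ⟨_, rfl⟩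
  have hθ' : 1 < 1 / θ := by rw [lt_div_iff₀ hθ]; linarith
  have hcpos : 0 < c := by rw [hc]; linarith
  have hε4 : 0 < ε / 4 := by linarith
  -- thresholds in `L = log N`
  obtain ⟨L₁, hL₁⟩ := exists_ratio_ge hθ κ hCG0 hε4
  obtain ⟨L₂, hL₂⟩ := exists_add_log_le_mul hcpos (18 - κ + 12)
  obtain ⟨L₃, hL₃⟩ := exists_err_le hcpos Cρ hε4
  obtain ⟨Lstar, hLstar⟩ : ∃ Lstar : ℝ,
      Lstar = max (max (max L₁ L₂) (max L₃ (4 * C₇ / ε))) (max (2 * CG + 2) 2) := ⟨_, rfl⟩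
  have hLs1 : L₁ ≤ Lstar := by rw [hLstar]; simp only [le_max_iff, le_refl, true_or]
  have hLs2 : L₂ ≤ Lstar := by rw [hLstar]; simp only [le_max_iff, le_refl, true_or, or_true]
  have hLs3 : L₃ ≤ Lstar := by rw [hLstar]; simp only [le_max_iff, le_refl, true_or, or_true]
  have hLs4 : 4 * C₇ / ε ≤ Lstar := by rw [hLstar]; simp only [le_max_iff, le_refl, true_or, or_true]
  have hLs5 : 2 * CG + 2 ≤ Lstar := by rw [hLstar]; simp only [le_max_iff, le_refl, true_or, or_true]
  have hLs6 : 2 ≤ Lstar := by rw [hLstar]; simp only [le_max_iff, le_refl, or_true]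
  -- `N*` and `T₀`
  obtain ⟨Nstar, hNstar⟩ : ∃ Nstar : ℕ, Nstar = ⌈Real.exp Lstar⌉₊ + 3 := ⟨_, rfl⟩
  refine ⟨((Nstar : ℝ) + 1) ^ (1 / θ), fun T hT a ha => ?_⟩
  obtain ⟨N, hNdef⟩ : ∃ N : ℕ, N = ⌊T ^ θ⌋₊ := ⟨_, rfl⟩
  rw [← hNdef]
  -- `T > 0`, `N ≥ N*`
  have hNs0 : (0 : ℝ) < (Nstar : ℝ) + 1 := by positivity
  have hT1 : 1 ≤ T := by
    refine le_trans ?_ hT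
    exact Real.one_le_rpow (by linarith) (by positivity)
  have hT0 : 0 < T := by linarith
  have hTθ : (Nstar : ℝ) + 1 ≤ T ^ θ := by
    have h := Real.rpow_le_rpow (by positivity) hT hθ.le
    rwa [← Real.rpow_mul hNs0.le, one_div_mul_cancel hθ.ne', Real.rpow_one] at h
  have hNge : Nstar ≤ N := by
    rw [hNdef]
    apply Nat.le_floor
    linarith
  have hN3 : 3 ≤ N := le_trans (by rw [hNstar]; omega) hNge
  have hN1 : 1 ≤ N := by omega
  have hNpos : (0 : ℝ) < N := by exact_mod_cast (show 0 < N by omega)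
  -- `L = log N ≥ L*`
  obtain ⟨L, hL⟩ : ∃ L : ℝ, L = Real.log N := ⟨_, rfl⟩
  have hLge : Lstar ≤ L := by
    have h1 : Real.exp Lstar ≤ Nstar := by
      rw [hNstar]; push_cast
      have := Nat.le_ceil (Real.exp Lstar)
      linarith
    have h2 : (Nstar : ℝ) ≤ N := by exact_mod_cast hNge
    rw [hL, ← Real.log_exp Lstar]
    exact Real.log_le_log (Real.exp_pos _) (h1.trans h2)
  have hL1' : L₁ ≤ L := hLs1.trans hLge
  have hL2' : L₂ ≤ L := hLs2.trans hLge
  have hL3' : L₃ ≤ L := hLs3.trans hLge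
  have hL4' : 4 * C₇ / ε ≤ L := hLs4.trans hLge
  have hL5' : 2 * CG + 2 ≤ L := hLs5.trans hLge
  have hL2 : 2 ≤ L := hLs6.trans hLge
  have hLpos : 0 < L := by linarith
  -- `log T ≥ L/θ` and `L_T ≥ L/θ + κ`
  have hlogT : L / θ ≤ Real.log T := by
    rw [div_le_iff₀ hθ]
    have hNT : (N : ℝ) ≤ T ^ θ := by
      rw [hNdef]; exact Nat.floor_le (by positivity)
    have := Real.log_le_log hNpos hNT
    rwa [Real.log_rpow hT0, mul_comm, ← hL] at this
  have hLT : 1 / θ * L + κ ≤ LT T := by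
    rw [LT, hκ, one_div_mul_eq_div]; linarith
  -- `G`
  have hGb := Gs_bounds (fun n hn => (hCG n hn)) hN1
  rw [← hL] at hGb
  have hG1 := one_le_Gs hN1
  have hGpos : 0 < Gs N := by linarith
  have hGlo : L / 2 ≤ Gs N := by linarith [hGb.1]
  have hGup : Gs N ≤ L + 1 + CG := hGb.2
  -- `A ≥ c L`
  obtain ⟨A, hAdef⟩ : ∃ A : ℝ, A = LT T - Real.log N - 6 - 4 * (Real.log (Real.log N) + 3) :=
    ⟨_, rfl⟩
  have hAge : c * L ≤ A := by
    have h := hL₂ L hL2'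
    rw [hAdef, ← hL]
    have h1 : (1 / θ - 1) * L + κ ≤ LT T - L := by nlinarith [hLT]
    have h2 : (1 / θ - 1) * L = 2 * (c * L) := by rw [hc]; ring
    linarith
  have hApos : 0 < A := lt_of_lt_of_le (by positivity) hAge
  -- the core bound
  have core := bchQuadForm_ge_core hN3 hT0 a ha hCρ0 (hCρ N hN3) (hC₇ N hN3) hAdef hApos
  rw [← hL] at core
  -- (e1) `L_T/G ≥ 1/θ − ε/4`
  have e1 : 1 / θ - ε / 4 ≤ LT T / Gs N := by
    have h := hL₁ L hL1'
    refine h.trans ?_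
    have hnum : 0 ≤ 1 / θ * L + κ := by nlinarith
    calc (1 / θ * L + κ) / (L + 1 + CG) ≤ (1 / θ * L + κ) / Gs N :=
          div_le_div_of_nonneg_left hnum hGpos hGup
      _ ≤ LT T / Gs N := div_le_div_of_nonneg_right hLT hGpos.le
  -- (e2) `C₇/log N ≤ ε/4`
  have e2 : C₇ / L ≤ ε / 4 := by
    rw [div_le_iff₀ hLpos]
    rw [div_le_iff₀ hε] at hL4'
    linarith
  -- (e3) `K²/(AG) ≤ ε/4`
  have e3 : (Cρ + Real.log L) ^ 2 / (A * Gs N) ≤ ε / 4 := by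
    have h := hL₃ L hL3'
    refine le_trans ?_ h
    apply div_le_div_of_nonneg_left (by positivity) (by positivity)
    exact mul_le_mul hAge hGlo (by positivity) hApos.le
  linarith

end PropB

/-- **Radziwiłł 2012, Proposition B, second relation — discharged.** Re-export in the
catalogue namespace. [cite: Radziwill2012, Proposition B and §7] -/
theorem Radziwill2012_propB_quadForm_holds : Radziwill2012_propB_quadForm :=
  PropB.Radziwill2012_propB_quadForm_holds

/-- **Proposition B reduced to its first relation**: the asymptotic
`𝓘(M_θ) = 𝒬_T(a) − 1 + o(1)` (`θ < ½`, uniformly over the admissible coefficients — the first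
relation of Proposition B, spelled out; it is the Balasubramanian–Conrey–Heath-Brown asymptotic plus
the twisted first moment, and is derived from the named fact
`BalasubramanianConreyHeathBrown1985_meanSquare` in
`MollifierLimitationsPropBAsymptoticProofs.lean`, `Radziwill2012_propB_asymptotic_of_BCH`) alone
now implies `Radziwill2012_propB`. [cite: Radziwill2012, Proposition B] -/
theorem Radziwill2012_propB_of_asymptotic
    (hA : ∀ θ : ℝ, 0 < θ → θ < 1 / 2 → ∀ C : ℝ → ℝ, ∀ ε : ℝ, 0 < ε →
      ∃ T₀ : ℝ, ∀ T : ℝ, T₀ ≤ T →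
        ∀ a : ℕ → ℂ, a 1 = 1 →
          (∀ δ : ℝ, 0 < δ → ∀ n : ℕ, 1 ≤ n → ‖a n‖ ≤ C δ * (n : ℝ) ^ δ) →
            |mollificationDefect (dirichletMollifier a ⌊T ^ θ⌋₊) T -
                (bchQuadForm T ⌊T ^ θ⌋₊ a - 1)| ≤ ε) :
    Radziwill2012_propB :=
  Radziwill2012_propB_of_parts hA Radziwill2012_propB_quadForm_holds

end Literature.Barriers.RiemannHypothesis
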